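import Summits.BirchSwinnertonDyer.BirchSwinnertonDyer.Theorems.SignedLowerHalvesKobayashiLowerHalfLargeImageKuriharaRigidityBinders
import Literature.NumberTheory.EllipticCurves.Kim2026.KatoMainIdentityOfUnitKuriharaNumber
import Literature.NumberTheory.EllipticCurves.CastellaSano2026.KatoMainIdentityOfKimTamagawaDefectOPEN
import HarnessLib

/-!
# Line `kurihara_rigidity` of crux `KobayashiLowerHalfLargeImage` (item stmt-BirchSwinnertonDyer-19001, route
# `SignedLowerHalves`): the lead's two composite binders and the two ENGINE stubs FROM NAMED FACTS BY NAME —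
# `Kim2026.thm111_katoMainIdentity_of_kuriharaNumber_ne_zero` (PUBLISHED, p607903) resp.
# `CastellaSano2026.thm1_katoMainIdentity_of_kimTamagawaDefect_OPEN` (PREPRINT claim, p607905), Kobayashi
# Thm. 1.2 and the period unit (cell `bsd-ssimc`, seat `bsd-line-slh-p1-w2`; `--supports … --as helper`)

The sibling `…KuriharaRigidityBinders` (p608118) derives the lead's binders `Kim2026_thm111_via_kobayashi74`
and `CastellaSano2026_thm1_via_kobayashi74_OPEN` (file
`Rank1Residual/Supersingular/KobayashiMainConjectureKuriharaRigidity.lean`, p606756) from DISPLAYED frames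
(the bodies of the two Literature statements, then still in flight) via Kobayashi's Thm. 7.4 (ii) run in the
kernel (`…KuriharaRigidityThm74`, p607446). Both statements have since LANDED; this file restates the four
theorems with the facts BY NAME, so that consumers (the lead's composition file of the line) can write
`Kim2026_thm111_via_kobayashi74_of_facts hKim h12 h5` with
`hKim : Kim2026.thm111_katoMainIdentity_of_kuriharaNumber_ne_zero`. Each proof is the sibling's theorem
applied to the unfolded fact (definitional unfolding only).

TRUST BASE of the two engines after this file (numbers, not adjectives): engine A ⟸ {Kim 2026 Thm. 1.11
(1) ⟹ (3) read on the `η = 1` package [PUBLISHED, cite], Kobayashi 2003 Thm. 1.2 [PUBLISHED], the period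
unit `realPeriodRat_eq_unit_mul_plusPeriod` [PUBLISHED]} — 3 named facts, 0 composite; engine B ⟸ {Castella–
Sano 2026 Thm. 1 (i) ⟹ (ii) on the package [PREPRINT claim], Kobayashi Thm. 1.2, the period unit}. HONEST
FRAMING (cell `bsd-ssimc`, D-0036/D-0074): TOOL THEOREMS ONLY, no definition, no named fact minted, no `sorry`,
axioms standard; CONDITIONAL on the named facts displayed as hypotheses; the class-wide crux, the line's HARD
stubs (Kim's Conjecture 1.10 on X7) and the route are NOT closed; nothing is booked; BSD is not proved by any
of this. `--supports stmt-BirchSwinnertonDyer-19001 --as helper`.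

References: [Kim2022StructureSelmer] Thm. 1.11 (PDF p. 8), §6; [CastellaSano2026] Thm. 1, Prop. 2.2.3, §2.4;
[Kobayashi2003] Thm. 1.2 (p. 2), Thm. 7.4 (p. 13); [GreenbergVatsal2000] §3 Rem. 3.4; [Mazur1978] Cor. 4.1.
-/

set_option autoImplicit false
-- single-problem summit (D-0017): the doubled namespace component is by design
set_option linter.dupNamespace false

noncomputable section

open scoped Classical MatrixGroups ModularForm

open CongruenceSubgroup Field WeierstrassCurve Literature.NumberTheory.EllipticCurves
  Literature.NumberTheory.EllipticCurves.ModularForms Literature.NumberTheory.GaloisRepresentations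
  Literature.NumberTheory.EllipticCurves.Rank1Residual Summit.BirchSwinnertonDyer.Rank1Residual.Supersingular

namespace Summit.BirchSwinnertonDyer.BirchSwinnertonDyer.Theorems.KuriharaRigidity

/-- **`Kim2026_thm111_via_kobayashi74` from three NAMED PUBLISHED facts**: Kim 2026 Thm. 1.11 (1) ⟹ (3) read
on the `η = 1` package (`hKim : Kim2026.thm111_katoMainIdentity_of_kuriharaNumber_ne_zero`), Kobayashi Thm.
1.2 (`h12`) and the period unit (`h5`) — by `kim2026_thm111_via_kobayashi74_of_katoFrame` (Kobayashi Thm. 7.4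
(ii) in the kernel). CONDITIONAL; closes nothing. [cite: Kim2022StructureSelmer, Thm. 1.11 (1) ⟹ (3) (PDF p. 8)]
[cite: Kobayashi2003, Thm. 7.4 (p. 13), Thm. 1.2 (p. 2)] -/
theorem kim2026_thm111_via_kobayashi74_of_facts
    (hKim : Kim2026.thm111_katoMainIdentity_of_kuriharaNumber_ne_zero)
    (h12 : Kobayashi2003.thm12_signedSelmerDual_finite_torsion)
    (h5 : realPeriodRat_eq_unit_mul_plusPeriod) : Kim2026_thm111_via_kobayashi74 :=
  kim2026_thm111_via_kobayashi74_of_katoFrame hKim h12 h5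

/-- **`CastellaSano2026_thm1_via_kobayashi74_OPEN` from the PREPRINT binder on the package BY NAME**
(`hCS : CastellaSano2026.thm1_katoMainIdentity_of_kimTamagawaDefect_OPEN`, [claim under-review] — never a
theorem), Kobayashi Thm. 1.2 (`h12`) and the period unit (`h5`) — by
`castellaSano2026_thm1_via_kobayashi74_OPEN_of_katoFrame`. CONDITIONAL; closes nothing.
[claim: CastellaSano2026, status: under-review] [cite: Kobayashi2003, Thm. 7.4 (p. 13), Thm. 1.2 (p. 2)] -/
theorem castellaSano2026_thm1_via_kobayashi74_OPEN_of_facts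
    (hCS : CastellaSano2026.thm1_katoMainIdentity_of_kimTamagawaDefect_OPEN)
    (h12 : Kobayashi2003.thm12_signedSelmerDual_finite_torsion)
    (h5 : realPeriodRat_eq_unit_mul_plusPeriod) : CastellaSano2026_thm1_via_kobayashi74_OPEN :=
  castellaSano2026_thm1_via_kobayashi74_OPEN_of_katoFrame hCS h12 h5

/-- **ENGINE A `stub_signedMC_of_kuriharaPartialInfty_eq_zero` (registered signature VERBATIM) from NAMED
facts**: `{Kim2026.thm111_katoMainIdentity_of_kuriharaNumber_ne_zero, thm12_signedSelmerDual_finite_torsion,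
realPeriodRat_eq_unit_mul_plusPeriod}`. CONDITIONAL; closes nothing.
[cite: Kim2022StructureSelmer, Thm. 1.11 (1) ⟹ (3) (PDF p. 8)] [cite: Kobayashi2003, Thm. 7.4 (p. 13), Thm. 1.2 (p. 2)] -/
theorem signedMC_of_kuriharaPartialInfty_eq_zero_of_facts
    (hKim : Kim2026.thm111_katoMainIdentity_of_kuriharaNumber_ne_zero)
    (h12 : Kobayashi2003.thm12_signedSelmerDual_finite_torsion)
    (h5 : realPeriodRat_eq_unit_mul_plusPeriod) :
    ∀ (W : WeierstrassCurve ℚ) [W.IsElliptic] [W.IsGloballyMinimal] (p : ℕ) [Fact p.Prime],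
      5 ≤ p → W.HasGoodReductionAtPrime p → W.frobeniusTrace p = 0 → Surj W p →
      ¬ p ∣ W.tamagawaProduct →
      (∀ [NeZero (W.conductorNorm ℤ)] (f : CuspForm (Gamma0 (W.conductorNorm ℤ)) 2),
          IsNewformOf W f → kuriharaPartialInfty W p f = 0) →
      ∀ ε : ℤˣ, KobayashiMainConjecture W p ε :=
  signedMC_of_kuriharaPartialInfty_eq_zero_of_katoFrame hKim h12 h5

/-- **ENGINE B `stub_signedMC_of_kimTamagawaDefect` (registered signature VERBATIM, reshape r2) from NAMED
inputs**: `{CastellaSano2026.thm1_katoMainIdentity_of_kimTamagawaDefect_OPEN [PREPRINT claim],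
thm12_signedSelmerDual_finite_torsion, realPeriodRat_eq_unit_mul_plusPeriod}`. CONDITIONAL; closes nothing.
[claim: CastellaSano2026, status: under-review] [cite: Kobayashi2003, Thm. 7.4 (p. 13), Thm. 1.2 (p. 2)] -/
theorem signedMC_of_kimTamagawaDefect_of_facts
    (hCS : CastellaSano2026.thm1_katoMainIdentity_of_kimTamagawaDefect_OPEN)
    (h12 : Kobayashi2003.thm12_signedSelmerDual_finite_torsion)
    (h5 : realPeriodRat_eq_unit_mul_plusPeriod) :
    ∀ (W : WeierstrassCurve ℚ) [W.IsElliptic] [W.IsGloballyMinimal] (p : ℕ) [Fact p.Prime],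
      5 ≤ p → W.HasGoodReductionAtPrime p → W.frobeniusTrace p = 0 → ¬ W.HasCM → Surj W p →
      (∀ [NeZero (W.conductorNorm ℤ)] (f : CuspForm (Gamma0 (W.conductorNorm ℤ)) 2),
          IsNewformOf W f →
            kuriharaPartialInfty W p f = (padicValNat p W.tamagawaProduct : ℕ∞)) →
      ∀ ε : ℤˣ, KobayashiMainConjecture W p ε :=
  signedMC_of_kimTamagawaDefect_of_katoFrame hCS h12 h5

end Summit.BirchSwinnertonDyer.BirchSwinnertonDyer.Theorems.KuriharaRigidity

end
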